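import Summits.QuantumFields.BalabanUV.T4Continuum.Support.NE3TangentFlatPush
import Summits.QuantumFields.BalabanUV.T4Continuum.Support.BlockAverageCurrentAbelian
import Summits.QuantumFields.BalabanUV.T4Continuum.Support.NE3FrameFreeDecompositionPrep
import HarnessLib

/-!
# NE7FlatAverageCurlCommutation — THE LINEARISED AVERAGE COMMUTES WITH THE LATTICE CURL AT THE FLAT BACKGROUND:
# `curl_1 (Q′X)(P) = L^{−d} Σ_{x ∈ B(P)} Σ_{i,j<L} curl_1 X (x + i e_μ + j e_ν; μ, ν)` (Bałaban's (48), on the torus chart), ANY `d`, ANY LEVEL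

ROAD-G115 §11 (xi) of the lineage `b2b-balaban-t4-ne7-p1` (CRUX PROVER NE7 #1 = OWNER of BINDER row NE7), generation 116; the «INTERFACE REQUEST
`curlSq_levelQ'_flat_le`» of [NE7P1-G115-INBOX-3] answered IN-HOUSE from tree lemmas only.
WHAT ([folklore]; 0 def, 0 sorry).  `T := D(coord_id L M 1)(0) : TDir (L·M) →L TDir M` is the differential of the chart coordinates of Bałaban's block
average (42) at the flat configuration (`levelQ' L N 0 1 = skewPR ∘ T`, `levelQ' L N (j+1) 1 = levelQ' L N j 1 ∘ T` — §4).
* §1 `curlAt_flatCfg`, `curlAt_flatCfg_eq_asum` (the flat dressed curl is the plain plaquette sum `A(∂p)`), `curlAt_flatCfg_add_period`.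
* §2 `fderiv_coord_flatCfg_apply`: `(T ψ)(r, κ) = T_c(ψ̃)`, `c = ⟨L·r, L·r + L e_κ⟩`, `ψ̃ = chartDir id (L·M) ψ` — by ✓ `AveragingDeficitChartCalculus.fderiv_coord_apply`
  (`D coord(0) = pushDir`) and ✓ `BlockAveragePushDirSplit.pushDir_flat` (`pushDir L 1 = Tside L`, Bałaban's first-order term (47) of (42)); `chartDir_fderiv_coord_flatCfg`
  (read on `ℤ^d`: `(Tψ)̃(x, κ) = T_{⟨Lx, Lx+Le_κ⟩}(ψ̃)`, periodicity by ✓ `SmoothRefineNeutral.Tside_add_period`).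
* §3 **`curlAt_chartDir_fderiv_coord_flatCfg`** — THE COMMUTATION: `curl_1 (Tψ)̃ (z; μ, ν) = Σ_{r ∈ [0,L)^d} L^{−d} • Σ_{i<L} Σ_{j<L} curl_1 ψ̃ (L•z + r + i•e_μ + j•e_ν; μ, ν)`
  — ✓ `BlockAverageCurrentAbelian.coarseFlux_eq_avg_stokes` (= [Balaban1985Averaging] (48) p. 25: the tree's `corner_cancellation` + `stokes`) read through §1–§2.
* §4 `Tside_mem_skewAdjoint`, `fderiv_coord_flatCfg_mem_skewSub` (`T` preserves `𝔲(n)`-valued fields), `coe_levelQ'_zero_flatCfg` (`↑(levelQ' 0 1 X) = T X` on skew `X`),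
  `levelQ'_succ_flatCfg` (`levelQ' (j+1) 1 X = levelQ' j 1 (T X)`, since `cavg L 1 = 1` ✓ `NE3TangentFlatPush.cavg_flatCfg`).
Consumer: `NE7CoarseCurlEnergyFlatSharp` (the SHARP, VOLUME-INDEPENDENT coarse-vs-fine Maxwell energy comparison `Σ_P ≤ L^{4−d}·Σ_p`, one step and all levels).
HONEST FRAMING: flat background only; kinematics of the linearised average; nothing of Bałaban's asserted (context only: [Balaban1985Averaging] (42), (47)–(48) p. 23–25);
NOT NE7 as a spine node, NOT NE3; spine 0∕9; NOT infinite volume, NOT mass gap, NOT BetaPertH, NOT Clay.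
-/

set_option autoImplicit false

open scoped BigOperators Matrix Matrix.Norms.L2Operator Topology
open NormedSpace Finset

namespace Summit.QuantumFields.BalabanUV.T4Continuum.NE7FlatAverageCurlCommutation

open Literature.MathematicalPhysics.QuantumFieldTheory.Balaban1983to89
open B7Prop1Explicit B7Prop2Explicit
open T4AveragingDeficitWall (curl curlAt Ad IsSkewDir)
open B8Ineq130 (Wcx_one)
open AveragingDeficitPeriodicCounting (IsPeriodicDir)
open AveragingDeficitTorusChart (TDir chart chartDir redN eq_wrap_add periodic_smul_vec isPeriodicDir_chartDir)
open AveragingDeficitChartCalculus (coord cavg fderiv_coord_apply)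
open AveragingDeficitTwoLevelPrep (skewSub skewPR skewPF skewPF_of_mem twoLevelQ')
open AveragingDeficitMultiLevelPrep (tower levelQ')
open AveragingDeficitResidualPairing (pushDir)
open BlockAveragePushDirSplit (pushDir_flat)
open BlockAverageCurrentAbelian (coarseFlux_eq_avg_stokes)
open SmoothRefineNeutral (Tside_add_period)
open NE3TangentFlatPush (flatCfg_eq_flat cavg_flatCfg)
open NE3FrameFreeDecompositionPrep (asum_mem_skewAdjoint)
open MinimalActionWitness (flatCfg)

noncomputable section

variable {d : ℕ} {n : Type*} [Fintype n] [DecidableEq n]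

/-! ## §1 The flat dressed curl is the plain plaquette sum -/

/-- The flat dressed curl, explicitly: `curl_1 ψ (z; μ, ν) = ψ(z, μ) + ψ(z + e_μ, ν) − ψ(z + e_ν, μ) − ψ(z, ν)`. [folklore] -/
theorem curlAt_flatCfg (ψ : Site d → Fin d → (Matrix n n ℂ)) (z : Site d) (μ ν : Fin d) :
    curlAt (flatCfg : Site d → Fin d → (Matrix n n ℂ)ˣ) ψ z μ ν = ψ z μ + ψ (z + e μ) ν - ψ (z + e ν) μ - ψ z ν := by
  simp only [curlAt, Ad, flatCfg, Units.val_one, inv_one, one_mul, mul_one]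

/-- The flat dressed curl is the abelian contour sum around the plaquette word: `curl_1 ψ (z; μ, ν) = ψ(∂p(z; μ, ν))`. [folklore] -/
theorem curlAt_flatCfg_eq_asum (ψ : Site d → Fin d → (Matrix n n ℂ)) (z : Site d) (μ ν : Fin d) :
    curlAt (flatCfg : Site d → Fin d → (Matrix n n ℂ)ˣ) ψ z μ ν = asum ψ z (plaqWord μ ν) := by
  rw [curlAt_flatCfg, asum_plaqWord]

/-- The flat dressed curl of a `P`-periodic direction field is `P`-periodic. [folklore] -/
theorem curlAt_flatCfg_add_period {ψ : Site d → Fin d → (Matrix n n ℂ)} {P : ℤ} (hψ : IsPeriodicDir ψ P) (z : Site d) (i μ ν : Fin d) :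
    curlAt (flatCfg : Site d → Fin d → (Matrix n n ℂ)ˣ) ψ (z + P • e i) μ ν = curlAt (flatCfg : Site d → Fin d → (Matrix n n ℂ)ˣ) ψ z μ ν := by
  classical
  simp only [curlAt_flatCfg, add_right_comm _ (P • e i), hψ _ i]

/-! ## §2 The differential of the chart coordinates of the average at the flat configuration is Bałaban's first-order term `T_c` -/

/-- At the flat configuration every loop variable `V(Γ_{c,x})V(c)⁻¹` of the average is `1`. [folklore] -/
theorem Wcx_flatCfg (L : ℕ) (q : Site d) (κ : Fin d) (r : Site d) : Wcx L (flatCfg : Site d → Fin d → (Matrix n n ℂ)ˣ) q κ r = 1 :=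
  Wcx_one L q κ r

/-- Hence the chart-calculus smallness hypothesis `‖V(Γ_{c,x})V(c)⁻¹ − 1‖ < 1` holds at the flat configuration. [folklore] -/
theorem norm_Wcx_flatCfg_sub_one_lt (L : ℕ) (q : Site d) (κ : Fin d) (r : Fin d → Fin L) :
    ‖((Wcx L (flatCfg : Site d → Fin d → (Matrix n n ℂ)ˣ) q κ (boxVec L r) : (Matrix n n ℂ)ˣ) : (Matrix n n ℂ)) - 1‖ < 1 := by
  rw [Wcx_flatCfg, Units.val_one, sub_self, norm_zero]
  exact one_pos

/-- **`D(coord_id L M 1)(0) ψ (r, κ) = T_{⟨L r, L r + L e_κ⟩}(ψ̃)`**: the differential of the chart coordinates of the block average at the flat configuration is Bałaban's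
first-order term `T_c = Σ_{x ∈ B(c₋)} L^{−d} ψ̃(Γ_{c,x})` of the periodic extension `ψ̃ = chartDir id (L·M) ψ`. [folklore] -/
theorem fderiv_coord_flatCfg_apply {L M : ℕ} [NeZero L] [NeZero M] [NeZero (L * M)] (ψ : TDir d n (L * M)) (r : Fin d → Fin M) (κ : Fin d) :
    (fderiv ℝ (coord (ContinuousLinearMap.id ℝ (Matrix n n ℂ)) L M (flatCfg : Site d → Fin d → (Matrix n n ℂ)ˣ)) 0) ψ r κ
      = Tside L (chartDir (ContinuousLinearMap.id ℝ (Matrix n n ℂ)) (L * M) ψ) ((L : ℤ) • boxVec M r) κ := by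
  have hL : 1 ≤ L := Nat.one_le_iff_ne_zero.mpr (NeZero.ne L)
  rw [fderiv_coord_apply (ContinuousLinearMap.id ℝ (Matrix n n ℂ)) L M (flatCfg : Site d → Fin d → (Matrix n n ℂ)ˣ)
    (fun q κ' r' => norm_Wcx_flatCfg_sub_one_lt L q κ' r') ψ r κ, flatCfg_eq_flat, pushDir_flat L hL]

/-- `T_c` of an `(L·M)`-periodic field is invariant under translations of `c` by the period lattice `(L·M)ℤ^d`. [folklore] -/
theorem Tside_add_smul_period (L M : ℕ) {ψ : Site d → Fin d → (Matrix n n ℂ)} (hψ : IsPeriodicDir ψ ((L * M : ℕ) : ℤ)) (q k : Site d) (κ : Fin d) :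
    Tside L ψ (q + ((L * M : ℕ) : ℤ) • k) κ = Tside L ψ q κ :=
  periodic_smul_vec (f := fun y => Tside L ψ y κ) (fun y τ => Tside_add_period L ψ hψ y κ τ) q k

/-- **The differential read on `ℤ^d`**: `(Tψ)̃(x, κ) = T_{⟨Lx, Lx + Le_κ⟩}(ψ̃)` for EVERY site `x` (not only the box representatives) — periodicity of `T_c(ψ̃)`. [folklore] -/
theorem chartDir_fderiv_coord_flatCfg {L M : ℕ} [NeZero L] [NeZero M] [NeZero (L * M)] (ψ : TDir d n (L * M)) (x : Site d) (κ : Fin d) :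
    chartDir (ContinuousLinearMap.id ℝ (Matrix n n ℂ)) M ((fderiv ℝ (coord (ContinuousLinearMap.id ℝ (Matrix n n ℂ)) L M (flatCfg : Site d → Fin d → (Matrix n n ℂ)ˣ)) 0) ψ) x κ
      = Tside L (chartDir (ContinuousLinearMap.id ℝ (Matrix n n ℂ)) (L * M) ψ) ((L : ℤ) • x) κ := by
  rw [chartDir, ContinuousLinearMap.coe_id', id, fderiv_coord_flatCfg_apply]
  conv_rhs => rw [eq_wrap_add M x, smul_add, smul_smul, ← Nat.cast_mul]
  exact (Tside_add_smul_period L M (isPeriodicDir_chartDir _ _ ψ) _ _ κ).symm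

/-! ## §3 THE COMMUTATION `curl ∘ T = (block average) ∘ curl` (Bałaban's (48) on the torus chart) -/

/-- **THE LINEARISED AVERAGE COMMUTES WITH THE CURL AT THE FLAT BACKGROUND** ([Balaban1985Averaging] (48): corner cancellation + abelian Stokes, by the tree's
✓ `coarseFlux_eq_avg_stokes`): for every `ψ ∈ TDir (L·M)`, every coarse site `z` and directions `μ, ν`,
`curl_1 (Tψ)̃ (z; μ, ν) = Σ_{r ∈ [0,L)^d} L^{−d} • Σ_{i<L} Σ_{j<L} curl_1 ψ̃ (L•z + r + i•e_μ + j•e_ν; μ, ν)` — the coarse curl of the averaged field is the BLOCK AVERAGE of the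
`L × L`-SQUARE sums of fine curls. [folklore] -/
theorem curlAt_chartDir_fderiv_coord_flatCfg {L M : ℕ} [NeZero L] [NeZero M] [NeZero (L * M)] (ψ : TDir d n (L * M)) (z : Site d) (μ ν : Fin d) :
    curlAt (flatCfg : Site d → Fin d → (Matrix n n ℂ)ˣ)
        (chartDir (ContinuousLinearMap.id ℝ (Matrix n n ℂ)) M ((fderiv ℝ (coord (ContinuousLinearMap.id ℝ (Matrix n n ℂ)) L M (flatCfg : Site d → Fin d → (Matrix n n ℂ)ˣ)) 0) ψ)) z μ ν
      = ∑ r : Fin d → Fin L, (((L : ℝ) ^ d)⁻¹ : ℝ) • ∑ i ∈ Finset.range L, ∑ j ∈ Finset.range L,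
          curlAt (flatCfg : Site d → Fin d → (Matrix n n ℂ)ˣ) (chartDir (ContinuousLinearMap.id ℝ (Matrix n n ℂ)) (L * M) ψ)
            ((L : ℤ) • z + boxVec L r + (i : ℤ) • e μ + (j : ℤ) • e ν) μ ν := by
  rw [curlAt_flatCfg]
  simp only [chartDir_fderiv_coord_flatCfg, smul_add, coarseFlux_eq_avg_stokes, curlAt_flatCfg_eq_asum]

/-! ## §4 `T` preserves skewness; `levelQ'` at the flat configuration is the iterate of `T` -/

/-- `T_c` of a `𝔲(n)`-valued field is `𝔲(n)`-valued (real weights, contour sums of skew matrices). [folklore] -/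
theorem Tside_mem_skewAdjoint (L : ℕ) {X : Site d → Fin d → (Matrix n n ℂ)} (hX : IsSkewDir X) (q : Site d) (κ : Fin d) : Tside L X q κ ∈ skewAdjoint (Matrix n n ℂ) := by
  unfold Tside
  exact AddSubgroup.sum_mem _ fun r _ => skewAdjoint.smul_mem _ (asum_mem_skewAdjoint hX _ _)

omit [Fintype n] [DecidableEq n] in
/-- The periodic extension (insert `id`) of a skew torus field is a skew direction field. [folklore] -/
theorem isSkewDir_chartDir_id {N : ℕ} [NeZero N] {ψ : TDir d n N} (hψ : ψ ∈ skewSub d n N) : IsSkewDir (chartDir (ContinuousLinearMap.id ℝ (Matrix n n ℂ)) N ψ) :=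
  fun x κ => by
    rw [chartDir, ContinuousLinearMap.coe_id', id]
    exact hψ (redN N x) κ

/-- **`T` maps skew fields to skew fields.** [folklore] -/
theorem fderiv_coord_flatCfg_mem_skewSub {L M : ℕ} [NeZero L] [NeZero M] [NeZero (L * M)] {ψ : TDir d n (L * M)} (hψ : ψ ∈ skewSub d n (L * M)) :
    (fderiv ℝ (coord (ContinuousLinearMap.id ℝ (Matrix n n ℂ)) L M (flatCfg : Site d → Fin d → (Matrix n n ℂ)ˣ)) 0) ψ ∈ skewSub d n M := by
  intro r κ
  rw [fderiv_coord_flatCfg_apply]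
  exact Tside_mem_skewAdjoint L (isSkewDir_chartDir_id hψ) _ _

/-- **One level**: on skew fields `↑(levelQ' L N 0 1 X) = T X` (`levelQ' 0 = twoLevelQ' = skewPR ∘ T`, and `skewPR` is the identity on skew fields). [folklore] -/
theorem coe_levelQ'_zero_flatCfg {L N : ℕ} [NeZero L] [NeZero N] [NeZero (L * N)] {X : TDir d n (L * N)} (hX : X ∈ skewSub d n (L * N)) :
    ((levelQ' L N 0 (flatCfg : Site d → Fin d → (Matrix n n ℂ)ˣ) X : ↥(skewSub d n N)) : TDir d n N)
      = (fderiv ℝ (coord (ContinuousLinearMap.id ℝ (Matrix n n ℂ)) L N (flatCfg : Site d → Fin d → (Matrix n n ℂ)ˣ)) 0) X := by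
  show ((twoLevelQ' L N (flatCfg : Site d → Fin d → (Matrix n n ℂ)ˣ) X : ↥(skewSub d n N)) : TDir d n N) = _
  rw [twoLevelQ', ContinuousLinearMap.comp_apply, skewPR, ContinuousLinearMap.coe_codRestrict_apply]
  exact skewPF_of_mem (fderiv_coord_flatCfg_mem_skewSub hX)

/-- **The recursion at the flat configuration**: `levelQ' L N (j+1) 1 X = levelQ' L N j 1 (T X)` (the average of the flat configuration is flat, ✓ `cavg_flatCfg`). [folklore] -/
theorem levelQ'_succ_flatCfg {L N : ℕ} [NeZero L] [NeZero N] (j : ℕ) (X : TDir d n (L * tower L N (j + 1))) :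
    levelQ' L N (j + 1) (flatCfg : Site d → Fin d → (Matrix n n ℂ)ˣ) X
      = levelQ' L N j (flatCfg : Site d → Fin d → (Matrix n n ℂ)ˣ)
          ((fderiv ℝ (coord (ContinuousLinearMap.id ℝ (Matrix n n ℂ)) L (L * tower L N j) (flatCfg : Site d → Fin d → (Matrix n n ℂ)ˣ)) 0) X) := by
  show ((levelQ' L N j (cavg L (flatCfg : Site d → Fin d → (Matrix n n ℂ)ˣ))).comp
      (fderiv ℝ (coord (ContinuousLinearMap.id ℝ (Matrix n n ℂ)) L (L * tower L N j) (flatCfg : Site d → Fin d → (Matrix n n ℂ)ˣ)) 0)) X = _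
  rw [ContinuousLinearMap.comp_apply, cavg_flatCfg]

end

end Summit.QuantumFields.BalabanUV.T4Continuum.NE7FlatAverageCurlCommutation
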